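import Summits.ResolutionOfSingularities.ResolutionOfSingularities.Theorems.PurelyInseparableDim4ResConeCInfGameStep
import Summits.ResolutionOfSingularities.ResolutionOfSingularities.Theorems.PurelyInseparableDim4ResConeShadeTwoStep
import HarnessLib
import HarnessLib.Audit.Tags

/-!
# Purely inseparable four-folds — C∞ WINDOW TOOLS FOR EVERY PRIME: row transport, straight readings from a straight
# residual cone, and the carried u-FLAG coefficient along a pure corner slot step of the light-pair power cone at
# `(p, p − 1)` (cell `res-dim4-pi`, K2(p) lane, rung-1 power-cone line «light pair of TAIL(p, p−1, 3) ∀ p», FILE 4 — the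
# p-3-lineage inputs of the typ-1 lineage's WINDOW HALF, asked for on the bus 2026-08-29 10:12Z (W1 (3)(a)))

[OURS · counted 0 · cell `res-dim4-pi` · K2(p) lane (holder res-dim4-p-12 g5); `(5, 4)` instances: `row_step_zero`
(`…CInfGameStep`, p-2 g4), `straight_readings_of_resForm` (`…CInfWindowLaws`, p-3 g4), `cInf_coeff_uFlag_step_zero` /
`cInf_uFlag_step_zero` (`…CInfNormalForm`, typ-1 g3); seat res-dim4-p-3 g5.]  Nothing here proves K2(p) for any `p`, any
TAIL(p, p−1, 3), `NoIsolatedTrap p p`, the Cossart–Jannsen–Saito theorem or resolution of singularities in dimension ≥ 4 /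
characteristic `p` — NOT proved.  AI kernel work, weaker than expert review.  Bookkeeping only; kills nothing.

Letters `j` (chart, a slot), `i` (the other slot), `u` (free), `f` (contact); `d + 1 = p`; pure corner step
`s′ = CentreBlowup.step p univ j 0 s`.
* `row_step_zero_exact_prime` — a `(u, f)`-bidegree row absent from `F` is absent from `F′` (the corner map moves only the
  `j`-exponent); `row_step_zero_prime` — the jet form `< N ↦ < N − d` (a parent of a child monomial has degree ≤ child
  degree `+ d`, the kept slot `i` having exponent `≥ 1`).
* `straight_readings_of_resForm_prime` — `resForm s = C a * X f ^ d`, `ord₀ F = d + 2`, `|r| = 2` ⇒ `coeff (r + d·e_f) F = a`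
  and every other residual degree-`d` reading vanishes (the coefficient-straightness binders of F3 ∀ p,
  `cInf_legal_readings_of_corner_prime`).
* `cInf_coeff_uFlag_step_zero_prime` / `cInf_uFlag_step_zero_prime` — the u-FLAG coefficient
  `coeff (r + λ + μ + (d−1)·u) F` (`r = λ + μ`) is CARRIED by a pure corner slot step (degree `d + 3`, chart exponent `2`,
  `u`-exponent `d − 1 = p − 2` is no multiple of `p`).
[cite: CossartJannsenSaito2020, Lemma 13.2] [cite: Hauser2010, §§F–G]
bears_on: LADDER-RESOLUTION:D157-DOOR2 (res-dim4-pi · K2(p) · power cones · window tools every prime).  Supports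
stmt-ResolutionOfSingularities-16155 (helper).
-/

set_option linter.dupNamespace false -- mandated namespace of this single-conjunct summit

noncomputable section

namespace Summit.ResolutionOfSingularities.ResolutionOfSingularities.Theorems.PIDim4

namespace ResCone

open MvPolynomial Finset
open Literature.AlgebraicGeometry.Resolution
open Literature.AlgebraicGeometry.Resolution.CentreBlowup
open Literature.AlgebraicGeometry.Resolution.Hauser2010
open Literature.AlgebraicGeometry.Resolution.HauserPerlega2019

variable {K : Type} [Field K] [DecidableEq K]

/-! ## 1. Row transport through a pure corner step, every prime -/

section Rows

variable {j i u f : Fin 4} (hji : j ≠ i) (hju : j ≠ u) (hjf : j ≠ f) (hiu : i ≠ u) (hif : i ≠ f) (huf : u ≠ f)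
include hji hju hjf hiu hif huf

omit hji hiu hif huf in
/-- **EXACT ROW TRANSPORT** (any `q`): a `(u, f)`-bidegree row absent from the parent is absent from the pure-corner child in
the chart of `j ∉ {u, f}` — the corner map changes the `j`-exponent only. [OURS] -/
theorem row_step_zero_exact_prime (q : ℕ) (s : State K) {eu ef : ℕ}
    (hrow : ∀ e ∈ s.F.support, ¬ (e u = eu ∧ e f = ef)) :
    ∀ e' ∈ (CentreBlowup.step q Finset.univ j 0 s).F.support, ¬ (e' u = eu ∧ e' f = ef) := by
  intro e' he'
  obtain ⟨e, he, heE⟩ := exists_of_mem_support_step_zero j s he'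
  subst heE
  rw [chartExponent_apply_of_ne q Finset.univ hjf.symm, chartExponent_apply_of_ne q Finset.univ hju.symm]
  exact hrow e he

/-- **ROW TRANSPORT, jet form** (`d + 1 = p`): if the slot `i` has exponent `≥ 1` in every parent monomial and every parent
monomial has degree `≥ p`, then absence of the `(u, f)`-row below degree `N` at the parent gives absence below `N − d` at the
pure-corner child (a parent has degree ≤ child degree `+ d`). [OURS] -/
theorem row_step_zero_prime (p : ℕ) {d : ℕ} (hdp : d + 1 = p) (s : State K) (hi1 : ∀ e ∈ s.F.support, 1 ≤ e i)
    (hp : ∀ e ∈ s.F.support, p ≤ e.degree) {N eu ef : ℕ}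
    (hrow : ∀ e ∈ s.F.support, e.degree < N → ¬ (e u = eu ∧ e f = ef)) :
    ∀ e' ∈ (CentreBlowup.step p Finset.univ j 0 s).F.support, e'.degree < N - d → ¬ (e' u = eu ∧ e' f = ef) := by
  intro e' he' hN'
  obtain ⟨e, he, heE⟩ := exists_of_mem_support_step_zero j s he'
  subst heE
  rw [chartExponent_apply_of_ne p Finset.univ hjf.symm, chartExponent_apply_of_ne p Finset.univ hju.symm]
  have hdeg := degree_eq_quad hji hju hjf hiu hif huf e
  have hdeg' := degree_eq_quad hji hju hjf hiu hif huf (chartExponent p Finset.univ j e)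
  rw [chartExponent_univ_apply_self, chartExponent_apply_of_ne p Finset.univ hji.symm,
    chartExponent_apply_of_ne p Finset.univ hju.symm, chartExponent_apply_of_ne p Finset.univ hjf.symm] at hdeg'
  have := hi1 e he
  have := hp e he
  exact hrow e he (by omega)

end Rows

/-! ## 2. Straight readings from a straight residual cone, every degree -/

omit [DecidableEq K] in
/-- **Straight readings from a straight residual cone** (any `d`): if `resForm s = a·x_f^d`, `ord₀ F = d + 2`, `|r| = 2`, then
`coeff_{r + d·e_f} F = a` and every other residual degree-`d` reading vanishes. [OURS · bookkeeping] -/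
theorem straight_readings_of_resForm_prime {f : Fin 4} {s : State K} {d : ℕ} (ho : ordZero s.F = ((d + 2 : ℕ) : ℕ∞))
    (hrdeg : s.r.degree = 2) {a : K} (hform : resForm s = C a * X f ^ d) :
    coeff (s.r + Finsupp.single f d) s.F = a ∧
      ∀ m : Fin 4 →₀ ℕ, m.degree = d → m ≠ Finsupp.single f d → coeff (s.r + m) s.F = 0 := by
  classical
  have hread : ∀ m : Fin 4 →₀ ℕ, m.degree = d → coeff (s.r + m) s.F = coeff m (C a * X f ^ d) := by
    intro m hm
    rw [← hform, coeff_resForm_eq_coeff_add ho (by rw [hm, hrdeg]; omega) (by rw [hrdeg]; omega)]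
  refine ⟨?_, fun m hm hne => ?_⟩
  · rw [hread _ (Finsupp.degree_single _ _), X_pow_eq_monomial, C_mul_monomial, mul_one, coeff_monomial, if_pos rfl]
  · rw [hread m hm, X_pow_eq_monomial, C_mul_monomial, mul_one, coeff_monomial, if_neg (Ne.symm hne)]

/-! ## 3. The u-FLAG coefficient is carried by a pure corner slot step, every prime -/

/-- **THE u-FLAG COEFFICIENT IS CARRIED** (`d + 1 = p`, `2 ≤ d`): for the slot ledger `r = λ + μ`, `ord₀ F = d + 2` and a
slot chart `j ∈ {λ, μ}`, the coefficient of `x^r · x_λ x_μ u^{d−1}` is the SAME at the pure-corner child: this exponent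
(degree `d + 3`, `j`-exponent `2`) is fixed by the chart law and is no `p`-th power (`u`-exponent `d − 1 = p − 2`).
[OURS] [cite: Hauser2010, §§F–G] -/
theorem cInf_coeff_uFlag_step_zero_prime (p : ℕ) {d : ℕ} (hdp : d + 1 = p) (hd2 : 2 ≤ d) {lam mu u j : Fin 4}
    (hlm : lam ≠ mu) (hul : u ≠ lam) (hum : u ≠ mu) (hj : j = lam ∨ j = mu) {s : State K}
    (hr : s.r = Finsupp.single lam 1 + Finsupp.single mu 1) (ho : ordZero s.F = ((d + 2 : ℕ) : ℕ∞)) :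
    coeff (s.r + (Finsupp.single lam 1 + Finsupp.single mu 1 + Finsupp.single u (d - 1)))
        (CentreBlowup.step p Finset.univ j 0 s).F =
      coeff (s.r + (Finsupp.single lam 1 + Finsupp.single mu 1 + Finsupp.single u (d - 1))) s.F := by
  have hq : ((p : ℕ) : ℕ∞) ≤ ordAlong Finset.univ s.F := by
    rw [ordAlong_univ, ho]; exact_mod_cast (by omega : p ≤ d + 2)
  have hdeg : (s.r + (Finsupp.single lam 1 + Finsupp.single mu 1 + Finsupp.single u (d - 1))).degree = d + 3 := by
    rw [hr]; simp only [map_add, Finsupp.degree_single]; omega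
  have hej : ((s.r + (Finsupp.single lam 1 + Finsupp.single mu 1 + Finsupp.single u (d - 1)) :
      Fin 4 →₀ ℕ)) j = 2 := by
    rcases hj with rfl | rfl
    · rw [hr]; simp [hlm.symm, hul]
    · rw [hr]; simp [hlm, hum]
  have heu : ((s.r + (Finsupp.single lam 1 + Finsupp.single mu 1 + Finsupp.single u (d - 1)) :
      Fin 4 →₀ ℕ)) u = d - 1 := by
    rw [hr]; simp [hul.symm, hum.symm]
  have hce : chartExponent p Finset.univ j
      (s.r + (Finsupp.single lam 1 + Finsupp.single mu 1 + Finsupp.single u (d - 1))) =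
      s.r + (Finsupp.single lam 1 + Finsupp.single mu 1 + Finsupp.single u (d - 1)) := by
    rw [chartExponent, degIn_univ, hdeg, show d + 3 - p = 2 by omega, ← hej, Finsupp.update_self]
  have h := coeff_step_zero_chartExponent p j s hq
    (e := s.r + (Finsupp.single lam 1 + Finsupp.single mu 1 + Finsupp.single u (d - 1))) (by rw [hdeg]; omega)
  rw [hce, if_neg (not_isPthPowerExponent_of_not_dvd (i := u) (by
    rw [heu]; intro hdvd; have := Nat.le_of_dvd (by omega) hdvd; omega))] at h
  exact h

/-- Hence the `u`-axis flag `coeff_{r + λ + μ + (d−1)u} F ≠ 0` PERSISTS along a pure corner slot step of the C∞ regime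
(`r′ = r` at order `d + 2 = p + 1`). [OURS] -/
theorem cInf_uFlag_step_zero_prime (p : ℕ) {d : ℕ} (hdp : d + 1 = p) (hd2 : 2 ≤ d) {lam mu u j : Fin 4}
    (hlm : lam ≠ mu) (hul : u ≠ lam) (hum : u ≠ mu) (hj : j = lam ∨ j = mu) {s : State K}
    (hr : s.r = Finsupp.single lam 1 + Finsupp.single mu 1) (ho : ordZero s.F = ((d + 2 : ℕ) : ℕ∞))
    (hV : coeff (s.r + (Finsupp.single lam 1 + Finsupp.single mu 1 + Finsupp.single u (d - 1))) s.F ≠ 0) :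
    coeff ((CentreBlowup.step p Finset.univ j 0 s).r +
        (Finsupp.single lam 1 + Finsupp.single mu 1 + Finsupp.single u (d - 1)))
      (CentreBlowup.step p Finset.univ j 0 s).F ≠ 0 := by
  have hrj : s.r j = 1 := by
    rcases hj with rfl | rfl
    · rw [hr, Finsupp.add_apply, Finsupp.single_eq_same, Finsupp.single_eq_of_ne hlm, add_zero]
    · rw [hr, Finsupp.add_apply, Finsupp.single_eq_of_ne (Ne.symm hlm), Finsupp.single_eq_same, zero_add]
  have ho1 : ordZero s.F = ((p + 1 : ℕ) : ℕ∞) := by rw [ho, show d + 2 = p + 1 by omega]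
  have hr' : (CentreBlowup.step p Finset.univ j 0 s).r = s.r := by
    rw [step_r_univ' p j 0 s ho1]
    ext k
    rw [Finsupp.coe_update]
    by_cases hk : k = j
    · rw [hk, Function.update_self, hrj]; omega
    · rw [Function.update_of_ne hk, Finsupp.filter_apply, if_pos (show (0 : Fin 4 → K) k = 0 from rfl)]
  rw [hr', cInf_coeff_uFlag_step_zero_prime p hdp hd2 hlm hul hum hj hr ho]
  exact hV

end ResCone

end Summit.ResolutionOfSingularities.ResolutionOfSingularities.Theorems.PIDim4

end
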